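import Summits.Ventures.Crystal3D.Theorems.StickyWulffConstantPolycrystalWulffBoundArrangementCells
import Summits.Ventures.Crystal3D.Theorems.StickyWulffConstantPolycrystalWulffBoundInclinedLamellarSections
import Summits.Ventures.Crystal3D.Theorems.StickyWulffConstantPolycrystalWulffBoundMinkowskiUpper
import HarnessLib

/-!
# TB-D assembly, part 11: CELL FLIPS — across a facet of an arrangement cell lies the flipped cell
# (lane T, crux `TextureLiminfV5`, stmt-Ventures-23912; blueprint HOME/wulff-p2/g20/TB-D-2-g20.md §1 (1d))

HONEST FRAMING. Venture `Summits/Ventures/Crystal3D` (cell `crystal3d-full`), route `route-Ventures-StickyWulffConstant`, helper `--supports` the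
law-v5 crux `TextureLiminfV5` (stmt-Ventures-23912).  Two small DEFINITIONS (`signedH`, `flipT`) + elementary geometry/measure theory (census-free, standard
axioms) on top of the P-lane's arrangement cells (…ArrangementCells).  Nothing about any cover or mesh; F-C1 not moved.

WHY.  In the blueprint the texture behind `stub_TB_energy` is a LABELLING of the cells of one hyperplane arrangement `𝓗` (positive parts `T ⊆ 𝓗`, cell
`polytope (signedH 𝓗 T)`).  The two classification hypotheses of the ledger splitting (…LedgerSplitFree/Wall) ask, per facet, «is the exposed part null?»
and «what touches here?».  For cells the answer is COMBINATORIAL: across the facet carried by the signed datum `q` lies the FLIPPED cell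
`polytope (signedH 𝓗 (flipT 𝓗 T q))`:
* `ball_subset_flip_and_self` — at a GENERIC facet point `y` (off every plane of `𝓗` other than `q`'s) a small ball splits into its near half (inside the
  cell) and its far half (inside the flipped cell); hence `mem_closure_flip`;
* `facetArea_nonGenericH_eq_zero` — the non-generic facet points form a `facetArea`-null set (finitely many other planes, each meeting `q`'s plane in a
  null set: `facetArea_eq_zero_of_subset_two_planes`);
* `facetArea_exposed_eq_zero_of_flip` — if the flipped cell is one of the OTHER pieces, the exposed part of the facet is null ((P1) «covered» rows);
* `signs_agree_of_not_disjoint` / `flip_mem_of_ae_subset` — if some far half-ball at a generic facet point is a.e. inside a finite union of cells `T i`,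
  the flipped positive part IS one of the `T i` (cells with different signs are disjoint; an open set of positive measure a.e. inside the union meets one
  of them in positive measure) — the engine of «material across ⇒ the flip is labelled».
-/

noncomputable section

namespace Summit.Ventures.Crystal3D.Cruxes.TextureLiminf.TexShadow

open Summit.Ventures.Crystal3D Summit.Ventures.Crystal3D.Theorems MeasureTheory Set
open scoped InnerProductSpace

/-! ### Signed constraint sets and flips -/

open scoped Classical in
/-- the signed constraint set of the cell with positive part `T` in the arrangement `𝓗` -/
def signedH (𝓗 T : Finset (E3 × ℝ)) : Finset (E3 × ℝ) := 𝓗.image (fun p : E3 × ℝ => if p ∈ T then p else (-p.1, -p.2))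

/-- the antipodal datum (same plane, opposite orientation) -/
def antip (q : E3 × ℝ) : E3 × ℝ := (-q.1, -q.2)

open scoped Classical in
/-- the positive part FLIPPED across the plane of the signed datum `q`: every `p ∈ 𝓗` on that plane (`p = q` or `p = antip q`) changes side -/
def flipT (𝓗 T : Finset (E3 × ℝ)) (q : E3 × ℝ) : Finset (E3 × ℝ) :=
  T.filter (fun p => ¬ (p = q ∨ p = antip q)) ∪ (𝓗 \ T).filter (fun p => p = q ∨ p = antip q)

/-- `antip` is an involution. -/
theorem antip_antip (q : E3 × ℝ) : antip (antip q) = q := by simp [antip]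

/-- Membership in a cell = the sign conditions. -/
theorem mem_polytope_signedH_iff (𝓗 T : Finset (E3 × ℝ)) (x : E3) :
    x ∈ polytope (signedH 𝓗 T) ↔ ∀ p ∈ 𝓗, (p ∈ T → ⟪p.1, x⟫_ℝ < p.2) ∧ (p ∉ T → p.2 < ⟪p.1, x⟫_ℝ) := by
  classical
  unfold polytope signedH
  rw [Finset.set_biInter_finset_image]
  simp only [mem_iInter, mem_setOf_eq]
  refine forall₂_congr fun p _ => ?_
  by_cases hpT : p ∈ T
  · simp [hpT]
  · simp [hpT, inner_neg_left]

/-- The closure of a cell satisfies the closed sign conditions. -/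
theorem closure_polytope_signedH_subset (𝓗 T : Finset (E3 × ℝ)) :
    closure (polytope (signedH 𝓗 T)) ⊆ {x : E3 | ∀ p ∈ 𝓗, (p ∈ T → ⟪p.1, x⟫_ℝ ≤ p.2) ∧ (p ∉ T → p.2 ≤ ⟪p.1, x⟫_ℝ)} := by
  refine closure_minimal (fun x hx => ?_) ?_
  · rw [mem_polytope_signedH_iff] at hx
    exact fun p hp => ⟨fun hpT => ((hx p hp).1 hpT).le, fun hpT => ((hx p hp).2 hpT).le⟩
  · have : {x : E3 | ∀ p ∈ 𝓗, (p ∈ T → ⟪p.1, x⟫_ℝ ≤ p.2) ∧ (p ∉ T → p.2 ≤ ⟪p.1, x⟫_ℝ)} =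
        ⋂ p ∈ 𝓗, ({x : E3 | p ∈ T → ⟪p.1, x⟫_ℝ ≤ p.2} ∩ {x : E3 | p ∉ T → p.2 ≤ ⟪p.1, x⟫_ℝ}) := by
      ext x; simp only [mem_setOf_eq, mem_iInter, mem_inter_iff]
    rw [this]
    refine isClosed_biInter fun p _ => IsClosed.inter ?_ ?_
    · by_cases hpT : p ∈ T
      · simp only [hpT, forall_true_left]
        exact isClosed_le (continuous_const.inner continuous_id) continuous_const
      · simp only [hpT, IsEmpty.forall_iff, setOf_true]; exact isClosed_univ
    · by_cases hpT : p ∈ T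
      · simp only [hpT, not_true_eq_false, IsEmpty.forall_iff, setOf_true]; exact isClosed_univ
      · simp only [hpT, not_false_eq_true, forall_true_left]
        exact isClosed_le continuous_const (continuous_const.inner continuous_id)

/-- Cells with a different sign at some `p ∈ 𝓗` are disjoint. -/
theorem disjoint_polytope_signedH (𝓗 T T' : Finset (E3 × ℝ)) {p : E3 × ℝ} (hp : p ∈ 𝓗) (hpT : p ∈ T) (hpT' : p ∉ T') :
    Disjoint (polytope (signedH 𝓗 T)) (polytope (signedH 𝓗 T')) := by
  rw [Set.disjoint_left]
  intro x hx hx'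
  rw [mem_polytope_signedH_iff] at hx hx'
  exact lt_asymm ((hx p hp).1 hpT) ((hx' p hp).2 hpT')

/-- Membership in `flipT`, off the plane of `q`: unchanged. -/
theorem mem_flipT_of_ne {𝓗 T : Finset (E3 × ℝ)} {q p : E3 × ℝ} (hp : p ∈ 𝓗) (hne : ¬ (p = q ∨ p = antip q)) :
    p ∈ flipT 𝓗 T q ↔ p ∈ T := by
  simp only [flipT, Finset.mem_union, Finset.mem_filter, Finset.mem_sdiff]
  tauto

/-- Membership in `flipT`, on the plane of `q`: flipped. -/
theorem mem_flipT_of_eq {𝓗 T : Finset (E3 × ℝ)} {q p : E3 × ℝ} (hp : p ∈ 𝓗) (heq : p = q ∨ p = antip q) :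
    p ∈ flipT 𝓗 T q ↔ p ∉ T := by
  simp only [flipT, Finset.mem_union, Finset.mem_filter, Finset.mem_sdiff]
  tauto

/-- `flipT ⊆ 𝓗` when `T ⊆ 𝓗`. -/
theorem flipT_subset {𝓗 T : Finset (E3 × ℝ)} (hT : T ⊆ 𝓗) (q : E3 × ℝ) : flipT 𝓗 T q ⊆ 𝓗 := by
  intro p hp
  simp only [flipT, Finset.mem_union, Finset.mem_filter, Finset.mem_sdiff] at hp
  rcases hp with ⟨h, -⟩ | ⟨⟨h, -⟩, -⟩
  · exact hT h
  · exact h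

/-- A signed datum `q` of the cell comes from some `p ∈ 𝓗` with `p = q` (positive) or `p = antip q` (negative); either way the cell lies in `{⟪q.1, x⟫ < q.2}`. -/
theorem exists_mem_of_mem_signedH {𝓗 T : Finset (E3 × ℝ)} {q : E3 × ℝ} (hq : q ∈ signedH 𝓗 T) :
    ∃ p ∈ 𝓗, (p ∈ T ∧ p = q) ∨ (p ∉ T ∧ p = antip q) := by
  obtain ⟨p, hp, hpq⟩ := Finset.mem_image.1 hq
  refine ⟨p, hp, ?_⟩
  by_cases hpT : p ∈ T
  · rw [if_pos hpT] at hpq; exact Or.inl ⟨hpT, hpq⟩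
  · rw [if_neg hpT] at hpq
    refine Or.inr ⟨hpT, ?_⟩
    simp only [antip, ← hpq, neg_neg]

/-- Signed data have unit normals when `𝓗` has. -/
theorem norm_fst_of_mem_signedH {𝓗 T : Finset (E3 × ℝ)} (h1 : ∀ p ∈ 𝓗, ‖p.1‖ = 1) {q : E3 × ℝ} (hq : q ∈ signedH 𝓗 T) : ‖q.1‖ = 1 := by
  obtain ⟨p, hp, h⟩ := exists_mem_of_mem_signedH hq
  rcases h with ⟨-, rfl⟩ | ⟨-, hpq⟩
  · exact h1 p hp
  · have : q = antip p := by rw [hpq, antip_antip]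
    rw [this]; simp only [antip, norm_neg]; exact h1 p hp

/-! ### The local picture at a generic facet point -/

/-- On a NONEMPTY cell, a datum of `𝓗` equal to the signed facet datum `q` is positive … -/
theorem mem_T_of_eq {𝓗 T : Finset (E3 × ℝ)} {q : E3 × ℝ} (hq : q ∈ signedH 𝓗 T) (hne : (polytope (signedH 𝓗 T)).Nonempty)
    {p : E3 × ℝ} (hp : p ∈ 𝓗) (hpq : p = q) : p ∈ T := by
  obtain ⟨x, hx⟩ := hne
  have hxq : ⟪q.1, x⟫_ℝ < q.2 := by
    have := hx; simp only [polytope, mem_iInter, mem_setOf_eq] at this; exact this q hq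
  rw [mem_polytope_signedH_iff] at hx
  by_contra hpT
  have h := (hx p hp).2 hpT
  rw [hpq] at h
  exact lt_asymm hxq h

/-- … and one equal to its antipode is negative. -/
theorem not_mem_T_of_eq_antip {𝓗 T : Finset (E3 × ℝ)} {q : E3 × ℝ} (hq : q ∈ signedH 𝓗 T) (hne : (polytope (signedH 𝓗 T)).Nonempty)
    {p : E3 × ℝ} (hp : p ∈ 𝓗) (hpq : p = antip q) : p ∉ T := by
  obtain ⟨x, hx⟩ := hne
  have hxq : ⟪q.1, x⟫_ℝ < q.2 := by
    have := hx; simp only [polytope, mem_iInter, mem_setOf_eq] at this; exact this q hq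
  rw [mem_polytope_signedH_iff] at hx
  intro hpT
  have h := (hx p hp).1 hpT
  rw [hpq] at h
  simp only [antip, inner_neg_left] at h
  linarith

/-- **At a generic facet point a small ball splits into the near half (inside the cell) and the far half (inside the flipped cell).**
`q ∈ signedH 𝓗 T` carries the facet, `⟪q.1, y⟫ = q.2`, `y ∈ cl (cell)`, and `y` lies on no other plane of `𝓗`. -/
theorem ball_subset_flip_and_self {𝓗 T : Finset (E3 × ℝ)} {q : E3 × ℝ} (hq : q ∈ signedH 𝓗 T) {y : E3}
    (hy : y ∈ closure (polytope (signedH 𝓗 T))) (hgen : ∀ p ∈ 𝓗, ¬ (p = q ∨ p = antip q) → ⟪p.1, y⟫_ℝ ≠ p.2) :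
    ∃ ε : ℝ, 0 < ε ∧ Metric.ball y ε ∩ {x : E3 | q.2 < ⟪q.1, x⟫_ℝ} ⊆ polytope (signedH 𝓗 (flipT 𝓗 T q)) ∧
      Metric.ball y ε ∩ {x : E3 | ⟪q.1, x⟫_ℝ < q.2} ⊆ polytope (signedH 𝓗 T) := by
  classical
  have hne : (polytope (signedH 𝓗 T)).Nonempty := by
    by_contra h
    rw [Set.not_nonempty_iff_eq_empty] at h
    rw [h, closure_empty] at hy
    exact hy
  have hcl := closure_polytope_signedH_subset 𝓗 T hy
  simp only [mem_setOf_eq] at hcl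
  -- strict sign conditions at `y` for every `p` off the plane of `q`, hence on a ball
  have hstrict : ∀ᶠ x in nhds y, ∀ p ∈ 𝓗.filter (fun p => ¬ (p = q ∨ p = antip q)),
      (p ∈ T → ⟪p.1, x⟫_ℝ < p.2) ∧ (p ∉ T → p.2 < ⟪p.1, x⟫_ℝ) := by
    rw [Filter.eventually_all_finset]
    intro p hp
    obtain ⟨hp𝓗, hne'⟩ := Finset.mem_filter.1 hp
    have hy_ne := hgen p hp𝓗 hne'
    by_cases hpT : p ∈ T
    · have hlt : ⟪p.1, y⟫_ℝ < p.2 := lt_of_le_of_ne ((hcl p hp𝓗).1 hpT) hy_ne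
      have hev : ∀ᶠ x in nhds y, ⟪p.1, x⟫_ℝ < p.2 := (isOpen_lt (continuous_const.inner continuous_id) continuous_const).mem_nhds hlt
      exact hev.mono fun x hx => ⟨fun _ => hx, fun h => absurd hpT h⟩
    · have hlt : p.2 < ⟪p.1, y⟫_ℝ := lt_of_le_of_ne ((hcl p hp𝓗).2 hpT) (Ne.symm hy_ne)
      have hev : ∀ᶠ x in nhds y, p.2 < ⟪p.1, x⟫_ℝ := (isOpen_lt continuous_const (continuous_const.inner continuous_id)).mem_nhds hlt
      exact hev.mono fun x hx => ⟨fun h => absurd h hpT, fun _ => hx⟩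
  obtain ⟨ε, hε, hball⟩ := Metric.eventually_nhds_iff_ball.1 hstrict
  refine ⟨ε, hε, ?_, ?_⟩
  · rintro x ⟨hx, hxq⟩
    simp only [mem_setOf_eq] at hxq
    rw [mem_polytope_signedH_iff]
    intro p hp
    by_cases hpq : p = q ∨ p = antip q
    · rw [mem_flipT_of_eq hp hpq]
      rcases hpq with hpq | hpq
      · have hpT := mem_T_of_eq hq hne hp hpq
        exact ⟨fun h => absurd hpT h, fun _ => by rw [hpq]; exact hxq⟩
      · have hpT := not_mem_T_of_eq_antip hq hne hp hpq
        refine ⟨fun _ => ?_, fun h => absurd hpT h⟩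
        rw [hpq]; simp only [antip, inner_neg_left]; linarith
    · rw [mem_flipT_of_ne hp hpq]
      exact hball x hx p (Finset.mem_filter.2 ⟨hp, hpq⟩)
  · rintro x ⟨hx, hxq⟩
    simp only [mem_setOf_eq] at hxq
    rw [mem_polytope_signedH_iff]
    intro p hp
    by_cases hpq : p = q ∨ p = antip q
    · rcases hpq with hpq | hpq
      · have hpT := mem_T_of_eq hq hne hp hpq
        exact ⟨fun _ => by rw [hpq]; exact hxq, fun h => absurd hpT h⟩
      · have hpT := not_mem_T_of_eq_antip hq hne hp hpq
        refine ⟨fun h => absurd h hpT, fun _ => ?_⟩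
        rw [hpq]; simp only [antip, inner_neg_left]; linarith
    · exact hball x hx p (Finset.mem_filter.2 ⟨hp, hpq⟩)

/-- **A generic facet point lies in the closure of the flipped cell** (unit normal of `q`). -/
theorem mem_closure_flip {𝓗 T : Finset (E3 × ℝ)} {q : E3 × ℝ} (hq : q ∈ signedH 𝓗 T) (hq1 : ‖q.1‖ = 1) {y : E3}
    (hyq : ⟪q.1, y⟫_ℝ = q.2) (hy : y ∈ closure (polytope (signedH 𝓗 T)))
    (hgen : ∀ p ∈ 𝓗, ¬ (p = q ∨ p = antip q) → ⟪p.1, y⟫_ℝ ≠ p.2) :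
    y ∈ closure (polytope (signedH 𝓗 (flipT 𝓗 T q))) := by
  obtain ⟨ε, hε, hfar, -⟩ := ball_subset_flip_and_self hq hy hgen
  rw [Metric.mem_closure_iff]
  intro δ hδ
  -- the point `y + (min ε δ / 2) • q.1` is on the far side, in the ball
  set t : ℝ := min ε δ / 2 with ht
  have ht0 : 0 < t := by positivity
  refine ⟨y + t • q.1, hfar ⟨?_, ?_⟩, ?_⟩
  · rw [Metric.mem_ball, dist_eq_norm, add_sub_cancel_left, norm_smul, hq1, mul_one, Real.norm_eq_abs, abs_of_pos ht0]
    linarith [min_le_left ε δ]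
  · simp only [mem_setOf_eq, inner_add_right, real_inner_smul_right, real_inner_self_eq_norm_sq, hq1, hyq]; nlinarith
  · rw [dist_eq_norm, sub_add_cancel_left, norm_neg, norm_smul, hq1, mul_one, Real.norm_eq_abs, abs_of_pos ht0]
    linarith [min_le_right ε δ]

/-! ### The non-generic part of a facet is null -/

/-- The points of the facet `q` of a bounded cell lying on some OTHER plane of `𝓗` form a `facetArea`-null set (unit normals). -/
theorem facetArea_nonGenericH_eq_zero {𝓗 T : Finset (E3 × ℝ)} (h1 : ∀ p ∈ 𝓗, ‖p.1‖ = 1) (hbd : Bornology.IsBounded (polytope (signedH 𝓗 T)))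
    {q : E3 × ℝ} (hq : q ∈ signedH 𝓗 T) :
    facetArea {y : E3 | y ∈ closure (polytope (signedH 𝓗 T)) ∧ ⟪q.1, y⟫_ℝ = q.2 ∧
      ∃ p ∈ 𝓗, ¬ (p = q ∨ p = antip q) ∧ ⟪p.1, y⟫_ℝ = p.2} q.1 = 0 := by
  classical
  have hq1 : ‖q.1‖ = 1 := norm_fst_of_mem_signedH h1 hq
  refine le_antisymm ?_ ENNReal.toReal_nonneg
  have h := facetArea_le_sum_of_subset_iUnion (𝓗.filter (fun p => ¬ (p = q ∨ p = antip q)))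
    {y : E3 | y ∈ closure (polytope (signedH 𝓗 T)) ∧ ⟪q.1, y⟫_ℝ = q.2 ∧ ∃ p ∈ 𝓗, ¬ (p = q ∨ p = antip q) ∧ ⟪p.1, y⟫_ℝ = p.2}
    (fun p => closure (polytope (signedH 𝓗 T)) ∩ ({x : E3 | ⟪q.1, x⟫_ℝ = q.2} ∩ {x : E3 | ⟪p.1, x⟫_ℝ = p.2})) q.1 ?_ ?_
  · refine h.trans (le_of_eq (Finset.sum_eq_zero fun p hp => ?_))
    obtain ⟨hp𝓗, hne⟩ := Finset.mem_filter.1 hp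
    refine facetArea_eq_zero_of_subset_two_planes (π := p) hq1 (h1 p hp𝓗) (fun x hx => hx.2) ?_
    intro heq
    rcases eq_or_eq_neg_of_setOf_inner_eq hq1 (h1 p hp𝓗) heq with ⟨ha, hb⟩ | ⟨ha, hb⟩
    · exact hne (Or.inl (Prod.ext ha hb))
    · exact hne (Or.inr (Prod.ext ha hb))
  · rintro y ⟨hy, hyq, p, hp, hne, hyp⟩
    exact mem_iUnion₂.2 ⟨p, Finset.mem_filter.2 ⟨hp, hne⟩, hy, hyq, hyp⟩
  · intro p _
    exact volume_prism_ne_top_of_isBounded hbd _ (fun x hx => hx.1) q.1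

/-! ### Covered facets and labelled flips -/

/-- **If the flipped cell is one of the OTHER pieces, the exposed part of the facet is null.**  Pieces `P i = polytope (Hp i)` indexed by a finite
type; the piece `i₀` is a cell `Hp i₀ = signedH 𝓗 T`, and some `i' ≠ i₀` has `polytope (Hp i') = polytope (signedH 𝓗 (flipT 𝓗 T q))`. -/
theorem facetArea_exposed_eq_zero_of_flip {ι : Type*} [Fintype ι] [DecidableEq ι] (Hp : ι → Finset (E3 × ℝ)) {𝓗 T : Finset (E3 × ℝ)}
    (h1 : ∀ p ∈ 𝓗, ‖p.1‖ = 1) {i₀ : ι} (hi₀ : Hp i₀ = signedH 𝓗 T) (hbd : Bornology.IsBounded (polytope (Hp i₀)))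
    {q : E3 × ℝ} (hq : q ∈ Hp i₀) {i' : ι} (hi' : i' ≠ i₀) (hflip : polytope (Hp i') = polytope (signedH 𝓗 (flipT 𝓗 T q))) :
    facetArea ((closure (polytope (Hp i₀)) ∩ {x : E3 | ⟪q.1, x⟫_ℝ = q.2}) \
      ⋃ i ∈ Finset.univ.erase i₀, closure (polytope (Hp i))) q.1 = 0 := by
  classical
  rw [hi₀] at hq hbd ⊢
  have hq1 : ‖q.1‖ = 1 := norm_fst_of_mem_signedH h1 hq
  refine le_antisymm ?_ ENNReal.toReal_nonneg
  have hsub : ((closure (polytope (signedH 𝓗 T)) ∩ {x : E3 | ⟪q.1, x⟫_ℝ = q.2}) \ ⋃ i ∈ Finset.univ.erase i₀, closure (polytope (Hp i))) ⊆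
      {y : E3 | y ∈ closure (polytope (signedH 𝓗 T)) ∧ ⟪q.1, y⟫_ℝ = q.2 ∧ ∃ p ∈ 𝓗, ¬ (p = q ∨ p = antip q) ∧ ⟪p.1, y⟫_ℝ = p.2} := by
    rintro y ⟨⟨hy, hyq⟩, hnot⟩
    refine ⟨hy, hyq, ?_⟩
    by_contra hgen
    push Not at hgen
    apply hnot
    refine mem_iUnion₂.2 ⟨i', Finset.mem_erase.2 ⟨hi', Finset.mem_univ _⟩, ?_⟩
    rw [hflip]
    exact mem_closure_flip hq hq1 hyq hy fun p hp hne => hgen p hp (not_or.1 hne)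
  have hmono := facetArea_le_sum_of_subset_iUnion ({(0 : ℕ)} : Finset ℕ)
    (((closure (polytope (signedH 𝓗 T)) ∩ {x : E3 | ⟪q.1, x⟫_ℝ = q.2}) \ ⋃ i ∈ Finset.univ.erase i₀, closure (polytope (Hp i))))
    (fun _ => {y : E3 | y ∈ closure (polytope (signedH 𝓗 T)) ∧ ⟪q.1, y⟫_ℝ = q.2 ∧ ∃ p ∈ 𝓗, ¬ (p = q ∨ p = antip q) ∧ ⟪p.1, y⟫_ℝ = p.2}) q.1
    (fun x hx => mem_iUnion₂.2 ⟨0, Finset.mem_singleton_self _, hsub hx⟩)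
    (fun _ _ => volume_prism_ne_top_of_isBounded hbd _ (fun x hx => hx.1) q.1)
  rw [Finset.sum_singleton, facetArea_nonGenericH_eq_zero h1 hbd hq] at hmono
  exact hmono

/-- Cells that are not disjoint have the same signs on `𝓗`. -/
theorem signs_agree_of_not_disjoint {𝓗 T T' : Finset (E3 × ℝ)} (h : ¬ Disjoint (polytope (signedH 𝓗 T)) (polytope (signedH 𝓗 T'))) :
    ∀ p ∈ 𝓗, (p ∈ T ↔ p ∈ T') := by
  intro p hp
  constructor
  · intro hpT
    by_contra hpT'
    exact h (disjoint_polytope_signedH 𝓗 T T' hp hpT hpT')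
  · intro hpT'
    by_contra hpT
    exact h (disjoint_polytope_signedH 𝓗 T' T hp hpT' hpT).symm

/-- Same signs on `𝓗` give the same signed constraint set. -/
theorem signedH_eq_of_signs_agree {𝓗 T T' : Finset (E3 × ℝ)} (h : ∀ p ∈ 𝓗, (p ∈ T ↔ p ∈ T')) : signedH 𝓗 T = signedH 𝓗 T' := by
  unfold signedH
  refine Finset.image_congr fun p hp => ?_
  simp only [h p hp]

/-- **Material across ⇒ the flip is one of the cells.**  If, at a generic facet point, some far half-ball is a.e. inside the union of finitely many cells
`polytope (signedH 𝓗 (T i))`, `i ∈ S`, then the flipped positive part has the signs of some `T i`, `i ∈ S` (so the flipped cell IS that cell). -/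
theorem flip_mem_of_ae_subset {ι : Type*} (S : Finset ι) (Tc : ι → Finset (E3 × ℝ)) {𝓗 T : Finset (E3 × ℝ)} {q : E3 × ℝ}
    (hq : q ∈ signedH 𝓗 T) (hq1 : ‖q.1‖ = 1) {y : E3} (hyq : ⟪q.1, y⟫_ℝ = q.2) (hy : y ∈ closure (polytope (signedH 𝓗 T)))
    (hgen : ∀ p ∈ 𝓗, ¬ (p = q ∨ p = antip q) → ⟪p.1, y⟫_ℝ ≠ p.2)
    {ρ : ℝ} (hρ : 0 < ρ) (hae : volume ((Metric.ball y ρ ∩ {x : E3 | q.2 < ⟪q.1, x⟫_ℝ}) \ ⋃ i ∈ S, polytope (signedH 𝓗 (Tc i))) = 0) :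
    ∃ i ∈ S, signedH 𝓗 (Tc i) = signedH 𝓗 (flipT 𝓗 T q) := by
  classical
  obtain ⟨ε, hε, hfar, -⟩ := ball_subset_flip_and_self hq hy hgen
  -- the open far half-ball of radius `min ε ρ` has positive measure
  set W : Set E3 := Metric.ball y (min ε ρ) ∩ {x : E3 | q.2 < ⟪q.1, x⟫_ℝ} with hW
  have hWo : IsOpen W := Metric.isOpen_ball.inter (isOpen_lt continuous_const (continuous_const.inner continuous_id))
  have hWne : W.Nonempty := by
    set t : ℝ := min ε ρ / 2 with ht
    have ht0 : 0 < t := by positivity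
    refine ⟨y + t • q.1, ?_, ?_⟩
    · rw [Metric.mem_ball, dist_eq_norm, add_sub_cancel_left, norm_smul, hq1, mul_one, Real.norm_eq_abs, abs_of_pos ht0]; linarith [lt_min hε hρ]
    · simp only [mem_setOf_eq, inner_add_right, real_inner_smul_right, real_inner_self_eq_norm_sq, hq1, hyq]; nlinarith
  have hWpos : 0 < volume W := hWo.measure_pos volume hWne
  have hWflip : W ⊆ polytope (signedH 𝓗 (flipT 𝓗 T q)) := fun x hx =>
    hfar ⟨Metric.ball_subset_ball (min_le_left _ _) hx.1, hx.2⟩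
  have hWsub : W ⊆ Metric.ball y ρ ∩ {x : E3 | q.2 < ⟪q.1, x⟫_ℝ} := fun x hx => ⟨Metric.ball_subset_ball (min_le_right _ _) hx.1, hx.2⟩
  -- hence `W` meets the union in positive measure, hence one of the cells in positive measure
  have hWae : volume (W \ ⋃ i ∈ S, polytope (signedH 𝓗 (Tc i))) = 0 :=
    measure_mono_null (show W \ (⋃ i ∈ S, polytope (signedH 𝓗 (Tc i))) ⊆
      (Metric.ball y ρ ∩ {x : E3 | q.2 < ⟪q.1, x⟫_ℝ}) \ ⋃ i ∈ S, polytope (signedH 𝓗 (Tc i)) from fun x hx => ⟨hWsub hx.1, hx.2⟩) hae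
  have hWint : 0 < volume (W ∩ ⋃ i ∈ S, polytope (signedH 𝓗 (Tc i))) := by
    have hle : volume W ≤ volume (W ∩ ⋃ i ∈ S, polytope (signedH 𝓗 (Tc i))) + volume (W \ ⋃ i ∈ S, polytope (signedH 𝓗 (Tc i))) := by
      conv_lhs => rw [← Set.inter_union_sdiff W (⋃ i ∈ S, polytope (signedH 𝓗 (Tc i)))]
      exact measure_union_le _ _
    rw [hWae, add_zero] at hle
    exact hWpos.trans_le hle
  rw [Set.inter_iUnion₂] at hWint
  have hle2 : volume (⋃ i ∈ S, W ∩ polytope (signedH 𝓗 (Tc i))) ≤ ∑ i ∈ S, volume (W ∩ polytope (signedH 𝓗 (Tc i))) :=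
    measure_biUnion_finset_le S (fun i => W ∩ polytope (signedH 𝓗 (Tc i)))
  have hpos : 0 < ∑ i ∈ S, volume (W ∩ polytope (signedH 𝓗 (Tc i))) := hWint.trans_le hle2
  obtain ⟨i, hi, hi0⟩ : ∃ i ∈ S, 0 < volume (W ∩ polytope (signedH 𝓗 (Tc i))) := by
    by_contra h
    push Not at h
    have hz : ∑ i ∈ S, volume (W ∩ polytope (signedH 𝓗 (Tc i))) = 0 :=
      Finset.sum_eq_zero fun i hi => le_antisymm (h i hi) bot_le
    rw [hz] at hpos
    exact lt_irrefl _ hpos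
  obtain ⟨x, hxW, hxi⟩ := MeasureTheory.nonempty_of_measure_ne_zero (μ := volume) hi0.ne'
  have hnd : ¬ Disjoint (polytope (signedH 𝓗 (Tc i))) (polytope (signedH 𝓗 (flipT 𝓗 T q))) :=
    Set.not_disjoint_iff.2 ⟨x, hxi, hWflip hxW⟩
  exact ⟨i, hi, signedH_eq_of_signs_agree (signs_agree_of_not_disjoint hnd)⟩

end Summit.Ventures.Crystal3D.Cruxes.TextureLiminf.TexShadow

end
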